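import Summits.HubbardSuperconductivity.HubbardSuperconductivity.Theorems.SoloBlindDimerGeometry
import HarnessLib

/-!
# The d-wave pair field on dimer configurations (solo-blind programme, Theorem 33 — matrix elements)

For the vertical-dimer configurations of `SoloBlindDimerGeometry` this file computes the matrix
elements of the d-wave pair field `Δ = pairField dWaveFormFactor L = Σ_x Σ_{e} (g_d(e)/√2)
(c_{x↑} c_{x+e,↓} - c_{x↓} c_{x+e,↑})` between dimer configurations
(`pairField_apply_dimerConfig`): for `S ⊆ slots` on an even torus of side `≥ 3`,

  `Δ (dimerConfig T, dimerConfig S) = Σ_z [z ∉ T ∧ S = T ∪ {z}] · (-√2)`,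

i.e. `Δ` removes exactly one dimer, with the COHERENT amplitude `-√2`: the bond of the dimer at `z`
is seen once as `(z, z+e₂)` (term `-c_{z↓}c_{z+e₂,↑}`, Jordan–Wigner sign `-1`, `sign_dn_up`) and
once as `(z+e₂, z)` (term `c_{z+e₂,↑}c_{z,↓}`, sign `+1`, `sign_up_dn`), each contributing
`g_d(±e₂)/√2 · (∓1)·(sign) = -1/√2`; the `±e₁` bonds and every other term vanish between dimer
configurations (`entry_dn_up_eq_zero`, `entry_up_dn_eq_zero`).  Also: the dimer basis vectors
`Φ_S = e_{dimerConfig S}` and the `j`-dimer condensate `Ψ_j = Σ_{#S=j} Φ_S` — orthonormality, norm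
`‖Ψ_j‖² = C(#slots, j)`, sector `(2j, S_z = 0)`, non-vanishing. [this work; elementary]
-/

noncomputable section

namespace Summit.HubbardSuperconductivity.HubbardSuperconductivity.Theorems.DimerCondensate

open Matrix Finset Literature.Probability.LatticeModels Literature.MathematicalPhysics.QuantumLattice
  Literature.MathematicalPhysics.QuantumLattice.EigenvalueContinuation
open scoped ComplexOrder ComplexConjugate

variable {L : ℕ} [NeZero L]

/-- Torus sites are compared through the linear order: this pins `DecidableEq (FermionTorus 2 L)`
(hence `insert`/`image` on orbital configurations) to the instance carried by the orbital-generic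
tree lemmas (`annihilation_apply`, `jwSign_insert_of_lt`, …), as in `DopedRVBState`. [folklore] -/
local instance (priority := high) instDecidableEqFermionTorusDimer₂ : DecidableEq (FermionTorus 2 L) :=
  LinearOrder.toDecidableEq

/-- The vertical unit step `e₂ = (0, 1)` of `ℤ²` (literal term). -/
local notation "𝐞" => (Pi.single 1 1 : Site 2)

/-- The down orbital `(k, ↓)` of the vertical dimer at `k`. -/
local notation "D[" k "]" => (orb (FermionTorus.ofTorusSite k) 1)

/-- The up orbital `(k + e₂, ↑)` of the vertical dimer at `k`. -/
local notation "U[" k "]" => (orb (FermionTorus.ofTorusSite (k + Torus.proj L 𝐞)) 0)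

/-! ### The dimer basis vectors and the condensate -/

/-- The basis vector of the dimer configuration `S`. -/
local notation "Φ[" S "]" => (Pi.single (dimerConfig S) (1 : ℂ) : Fock (Orb (FermionTorus 2 L)))

/-- The `j`-dimer condensate: the unsigned sum of all dimer configurations on `j` slots. -/
local notation "Ψ[" j "]" => (∑ S ∈ Finset.powersetCard j (dimerSlots L), Φ[S])

omit [NeZero L] in
/-- `⟨e_t, v⟩ = v t`. [folklore] -/
private theorem star_single_dotProduct (t : Finset (Orb (FermionTorus 2 L))) (v : Fock (Orb (FermionTorus 2 L))) :
    star (Pi.single t (1 : ℂ) : Fock (Orb (FermionTorus 2 L))) ⬝ᵥ v = v t := by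
  rw [← Pi.single_star, star_one, single_dotProduct, one_mul]

omit [NeZero L] in
/-- `(M e_s) t = M t s`. [folklore] -/
private theorem mulVec_single_one_apply (M : Matrix (Finset (Orb (FermionTorus 2 L))) (Finset (Orb (FermionTorus 2 L))) ℂ)
    (t s : Finset (Orb (FermionTorus 2 L))) :
    (M *ᵥ (Pi.single s (1 : ℂ) : Fock (Orb (FermionTorus 2 L)))) t = M t s := by
  rw [mulVec_single_one]; rfl

/-- Orthonormality of the dimer basis vectors (file-local: its notation-normalised text coincides
with the momentum-pair orthonormality `PairCondensate.star_paired_dotProduct_paired`, a statement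
about different vectors). [folklore] -/
private theorem star_basis_dotProduct_basis (S T : Finset (TorusSite 2 L)) :
    star Φ[T] ⬝ᵥ Φ[S] = if S = T then 1 else 0 := by
  rw [star_single_dotProduct, Pi.single_apply]
  by_cases h : S = T
  · rw [if_pos h, if_pos (congrArg dimerConfig h).symm]
  · rw [if_neg h, if_neg (fun h' => h (dimerConfig_injective h').symm)]

/-- Overlap of a basis vector with the condensate. [folklore] -/
theorem star_basis_dotProduct_condensate (T : Finset (TorusSite 2 L)) (j : ℕ) :
    star Φ[T] ⬝ᵥ Ψ[j] = if T ∈ (dimerSlots L).powersetCard j then 1 else 0 := by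
  rw [dotProduct_sum]
  simp_rw [star_basis_dotProduct_basis]
  rw [Finset.sum_ite_eq']

/-- **Norm of the condensate**: `‖Ψ_j‖² = C(#slots, j)`. [folklore] -/
theorem star_condensate_dotProduct_self (j : ℕ) :
    star Ψ[j] ⬝ᵥ Ψ[j] = ((((dimerSlots L).powersetCard j).card : ℕ) : ℂ) := by
  conv_lhs => rw [star_sum, sum_dotProduct]
  simp_rw [star_basis_dotProduct_condensate]
  rw [Finset.sum_ite_mem, Finset.inter_self, Finset.sum_const, nsmul_eq_mul, mul_one]

/-- A dimer configuration on `j` slots lies in the sector `(N, 2S_z) = (2j, 0)`. [folklore] -/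
theorem basis_mem_szSector {S : Finset (TorusSite 2 L)} {j : ℕ} (hS : S.card = j) :
    (Φ[S] : Fock (Orb (FermionTorus 2 L))) ∈ szSector (Λ := FermionTorus 2 L) (2 * j) 0 := by
  rw [mem_szSector_two_mul_zero_iff]
  intro s hs
  rw [Pi.single_apply, if_neg]
  rintro rfl
  exact hs ⟨by rw [up_card_dimerConfig, hS], by rw [dn_card_dimerConfig, hS]⟩

/-- **The condensate lies in the sector `(2j, 0)`.** [folklore] -/
theorem condensate_mem_szSector (j : ℕ) :
    (Ψ[j] : Fock (Orb (FermionTorus 2 L))) ∈ szSector (Λ := FermionTorus 2 L) (2 * j) 0 :=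
  Submodule.sum_mem _ fun _ hS => basis_mem_szSector (Finset.mem_powersetCard.1 hS).2

/-- **The condensate is non-zero** when `j ≤ #slots`. [folklore] -/
theorem condensate_ne_zero {j : ℕ} (hj : j ≤ (dimerSlots L).card) :
    (Ψ[j] : Fock (Orb (FermionTorus 2 L))) ≠ 0 := by
  intro h
  have h1 := star_condensate_dotProduct_self (L := L) j
  rw [h, dotProduct_zero] at h1
  have h2 : (((dimerSlots L).powersetCard j).card : ℂ) ≠ 0 := by
    rw [Finset.card_powersetCard, Nat.cast_ne_zero]
    exact (Nat.choose_pos hj).ne'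
  exact h2 h1.symm

/-! ### Matrix entries of the d-wave pair field between dimer configurations -/

omit [NeZero L] in
/-- Entries of a product of two annihilators (general Slater-determinant bookkeeping). [folklore] -/
theorem annihilation_mul_annihilation_apply (a b : Orb (FermionTorus 2 L))
    (t s : Finset (Orb (FermionTorus 2 L))) :
    (annihilation a * annihilation b) t s =
      if a ∉ t ∧ b ∉ insert a t ∧ s = insert b (insert a t) then
        jwSign a t * jwSign b (insert a t) else 0 := by
  rw [Matrix.mul_apply]
  by_cases ha : a ∉ t
  · rw [Finset.sum_eq_single (insert a t)]
    · rw [annihilation_apply, if_pos ⟨ha, rfl⟩, annihilation_apply]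
      by_cases hb : b ∉ insert a t ∧ s = insert b (insert a t)
      · rw [if_pos hb, if_pos ⟨ha, hb⟩]
      · rw [if_neg hb, mul_zero, if_neg (fun h => hb h.2)]
    · intro u _ hu
      rw [annihilation_apply, if_neg (fun h => hu h.2), zero_mul]
    · intro h; exact absurd (Finset.mem_univ _) h
  · rw [if_neg (fun h => ha h.1)]
    refine Finset.sum_eq_zero fun u _ => ?_
    rw [annihilation_apply, if_neg (fun h => ha h.1), zero_mul]

/-- The pair field unfolded into its two-annihilator terms. [folklore] -/
theorem pairField_apply_eq (g : (Fin 2 → ℤ) → ℝ) (t s : Finset (Orb (FermionTorus 2 L))) :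
    pairField g L t s = ∑ x : TorusSite 2 L, ∑ e ∈ insert (0 : Fin 2 → ℤ) unitSteps,
      ((g e / Real.sqrt 2 : ℝ) : ℂ) *
        ((annihilation (orb (FermionTorus.ofTorusSite x) 0) *
            annihilation (orb (FermionTorus.ofTorusSite (x + Torus.proj L e)) 1)) t s -
          (annihilation (orb (FermionTorus.ofTorusSite x) 1) *
            annihilation (orb (FermionTorus.ofTorusSite (x + Torus.proj L e)) 0)) t s) := by
  simp only [pairField, localPair, Matrix.sum_apply, Matrix.smul_apply, Matrix.sub_apply,
    smul_eq_mul]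

omit [NeZero L] in
/-- `Torus.proj` is odd. [folklore] -/
private theorem proj_neg (e : Site 2) : Torus.proj L (-e) = -Torus.proj L e := by
  funext i; simp [Torus.proj_apply]

/-- `e₂` is one of the steps `0, ±e₁, ±e₂`. [folklore] -/
private theorem e2_mem_steps : (𝐞 : Site 2) ∈ insert (0 : Site 2) unitSteps := by simp [unitSteps]

/-- `-e₂` is one of the steps `0, ±e₁, ±e₂`. [folklore] -/
private theorem neg_e2_mem_steps : (-𝐞 : Site 2) ∈ insert (0 : Site 2) unitSteps := by simp [unitSteps]

/-- `g_d(e₂) = -1`. [folklore] -/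
private theorem dWave_e2 : dWaveFormFactor 𝐞 = -1 := by
  rw [dWaveFormFactor, if_neg (by decide), if_pos (Or.inl rfl)]

/-- `g_d(-e₂) = -1`. [folklore] -/
private theorem dWave_neg_e2 : dWaveFormFactor (-𝐞) = -1 := by
  rw [dWaveFormFactor, if_neg (by decide), if_pos (Or.inr rfl)]

/-- The `c_{x↓} c_{x+e,↑}` entry between dimer configurations vanishes unless `e = e₂`.
[folklore] -/
theorem entry_dn_up_eq_zero (hL : 3 ≤ L) {e : Site 2} (he : e ∈ insert (0 : Site 2) unitSteps)
    (hne : e ≠ 𝐞) (x : TorusSite 2 L) (S T : Finset (TorusSite 2 L)) :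
    (annihilation (orb (FermionTorus.ofTorusSite x) 1) *
        annihilation (orb (FermionTorus.ofTorusSite (x + Torus.proj L e)) 0))
      (dimerConfig T) (dimerConfig S) = 0 := by
  rw [annihilation_mul_annihilation_apply, if_neg]
  rintro ⟨-, h2, h3⟩
  have hq : orb (FermionTorus.ofTorusSite (x + Torus.proj L e)) 0 ∈ dimerConfig S := by
    rw [h3]; exact mem_insert_self _ _
  rw [orb_zero_mem_dimerConfig, eq_insert_of_dimerConfig_eq (fun y => dn_ne_orb_zero y _) h3,
    mem_insert] at hq
  rcases hq with h | h
  · apply hne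
    have h' : Torus.proj L e - Torus.proj L 𝐞 = (x + Torus.proj L e - Torus.proj L 𝐞) - x := by
      abel
    rw [h, sub_self, sub_eq_zero] at h'
    exact PairFieldYang.torusProj_injOn_insert_zero_unitSteps hL he e2_mem_steps h'
  · exact h2 (mem_insert_of_mem ((orb_zero_mem_dimerConfig T _).2 h))

/-- The `c_{x↓} c_{x+e₂,↑}` entry: it removes the dimer at `x`. [folklore] -/
theorem entry_dn_up_e2 (x : TorusSite 2 L) (S T : Finset (TorusSite 2 L)) :
    (annihilation D[x] * annihilation U[x]) (dimerConfig T) (dimerConfig S) =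
      if x ∉ T ∧ S = insert x T then
        jwSign D[x] (dimerConfig T) * jwSign U[x] (insert D[x] (dimerConfig T)) else 0 := by
  rw [annihilation_mul_annihilation_apply]
  by_cases h : x ∉ T ∧ S = insert x T
  · rw [if_pos h, if_pos]
    refine ⟨by rw [dn_mem_dimerConfig]; exact h.1, ?_, by rw [h.2, dimerConfig_insert]⟩
    rw [mem_insert, not_or, up_mem_dimerConfig]
    exact ⟨up_ne_dn x x, h.1⟩
  · rw [if_neg h, if_neg]
    rintro ⟨h1, -, h3⟩
    exact h ⟨by rwa [dn_mem_dimerConfig] at h1,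
      eq_insert_of_dimerConfig_eq (fun y => dn_ne_up y x) h3⟩

/-- The `c_{x↑} c_{x+e,↓}` entry between dimer configurations vanishes unless `e = -e₂`.
[folklore] -/
theorem entry_up_dn_eq_zero (hL : 3 ≤ L) {e : Site 2} (he : e ∈ insert (0 : Site 2) unitSteps)
    (hne : e ≠ -𝐞) (x : TorusSite 2 L) (S T : Finset (TorusSite 2 L)) :
    (annihilation (orb (FermionTorus.ofTorusSite x) 0) *
        annihilation (orb (FermionTorus.ofTorusSite (x + Torus.proj L e)) 1))
      (dimerConfig T) (dimerConfig S) = 0 := by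
  rw [annihilation_mul_annihilation_apply, if_neg]
  rintro ⟨h1, -, h3⟩
  have hp : orb (FermionTorus.ofTorusSite x) 0 ∈ dimerConfig S := by
    rw [h3]; exact mem_insert_of_mem (mem_insert_self _ _)
  rw [Finset.insert_comm] at h3
  rw [orb_zero_mem_dimerConfig, eq_insert_of_dimerConfig_eq (fun y => dn_ne_orb_zero y _) h3,
    mem_insert] at hp
  rcases hp with h | h
  · apply hne
    have h0 : Torus.proj L e + Torus.proj L 𝐞 =
        (x + Torus.proj L e) - (x - Torus.proj L 𝐞) := by abel
    rw [← h, sub_self] at h0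
    exact PairFieldYang.torusProj_injOn_insert_zero_unitSteps hL he neg_e2_mem_steps
      (by rw [proj_neg]; exact eq_neg_of_add_eq_zero_left h0)
  · exact h1 ((orb_zero_mem_dimerConfig T _).2 h)

/-- The `c_{z+e₂,↑} c_{z,↓}` entry: it removes the dimer at `z`. [folklore] -/
theorem entry_up_dn_e2 (z : TorusSite 2 L) (S T : Finset (TorusSite 2 L)) :
    (annihilation U[z] * annihilation D[z]) (dimerConfig T) (dimerConfig S) =
      if z ∉ T ∧ S = insert z T then
        jwSign U[z] (dimerConfig T) * jwSign D[z] (insert U[z] (dimerConfig T)) else 0 := by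
  rw [annihilation_mul_annihilation_apply]
  by_cases h : z ∉ T ∧ S = insert z T
  · rw [if_pos h, if_pos]
    refine ⟨by rw [up_mem_dimerConfig]; exact h.1, ?_,
      by rw [h.2, dimerConfig_insert, Finset.insert_comm]⟩
    rw [mem_insert, not_or, dn_mem_dimerConfig]
    exact ⟨dn_ne_up z z, h.1⟩
  · rw [if_neg h, if_neg]
    rintro ⟨h1, -, h3⟩
    rw [Finset.insert_comm] at h3
    exact h ⟨by rwa [up_mem_dimerConfig] at h1,
      eq_insert_of_dimerConfig_eq (fun y => dn_ne_up y z) h3⟩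

/-- Signs, I: removing the dimer at a slot `z` in the order `c_{z+e₂,↑} c_{z,↓}` has sign `+1`.
[folklore] -/
theorem sign_up_dn (hL : Even L) {z : TorusSite 2 L} (hz : z ∈ dimerSlots L)
    {T : Finset (TorusSite 2 L)} (hzT : z ∉ T) :
    jwSign U[z] (dimerConfig T) * jwSign D[z] (insert U[z] (dimerConfig T)) = 1 := by
  have hD : D[z] ∉ dimerConfig T := by rwa [dn_mem_dimerConfig]
  rw [jwSign_insert_of_not_lt (not_lt.2 (dn_lt_up hL hz).le), jwSign_up_eq_jwSign_dn hL hz hD,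
    jwSign_mul_self]

/-- Signs, II: in the order `c_{z,↓} c_{z+e₂,↑}` the sign is `-1` (one Jordan–Wigner crossing).
[folklore] -/
theorem sign_dn_up (hL : Even L) {z : TorusSite 2 L} (hz : z ∈ dimerSlots L)
    {T : Finset (TorusSite 2 L)} (hzT : z ∉ T) :
    jwSign D[z] (dimerConfig T) * jwSign U[z] (insert D[z] (dimerConfig T)) = -1 := by
  have hD : D[z] ∉ dimerConfig T := by rwa [dn_mem_dimerConfig]
  rw [jwSign_insert_of_lt hD (dn_lt_up hL hz), jwSign_up_eq_jwSign_dn hL hz hD, mul_neg,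
    jwSign_mul_self]

omit [NeZero L] in
/-- `z + e₂ + (-e₂) = z` on the torus. [folklore] -/
theorem shift_cancel (z : TorusSite 2 L) : z + Torus.proj L 𝐞 + Torus.proj L (-𝐞) = z := by
  rw [proj_neg, add_neg_cancel_right]

/-- `(-1/√2)·1 - (-1/√2)·(-1) = -√2`. [folklore] -/
theorem sqrt_two_aux :
    ((-1 / Real.sqrt 2 : ℝ) : ℂ) * 1 - ((-1 / Real.sqrt 2 : ℝ) : ℂ) * (-1) =
      -((Real.sqrt 2 : ℝ) : ℂ) := by
  have hs : Real.sqrt 2 ≠ 0 := (Real.sqrt_pos.2 two_pos).ne'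
  have hsq : Real.sqrt 2 * Real.sqrt 2 = 2 := Real.mul_self_sqrt (by norm_num)
  have h : (-1 / Real.sqrt 2 : ℝ) * 1 - (-1 / Real.sqrt 2) * (-1) = -Real.sqrt 2 := by
    field_simp
    linarith [hsq]
  exact_mod_cast h

/-- **Pair-field matrix elements between dimer configurations.** For `S ⊆ slots` on an even torus
of side `≥ 3`, `Δ_d (dimerConfig T, dimerConfig S) = Σ_z [z ∉ T ∧ S = T ∪ {z}] · (-√2)`: the
d-wave pair field removes one dimer, with amplitude `-(g_d(e₂) + g_d(-e₂))/√2 · (JW sign) = -√2`.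
[this work; elementary] -/
theorem pairField_apply_dimerConfig (hL3 : 3 ≤ L) (hL : Even L) {S : Finset (TorusSite 2 L)}
    (hS : S ⊆ dimerSlots L) (T : Finset (TorusSite 2 L)) :
    pairField dWaveFormFactor L (dimerConfig T) (dimerConfig S) =
      ∑ z : TorusSite 2 L, if z ∉ T ∧ S = insert z T then -((Real.sqrt 2 : ℝ) : ℂ) else 0 := by
  rw [pairField_apply_eq]
  have key : ∀ x : TorusSite 2 L,
      (∑ e ∈ insert (0 : Fin 2 → ℤ) unitSteps, ((dWaveFormFactor e / Real.sqrt 2 : ℝ) : ℂ) *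
        ((annihilation (orb (FermionTorus.ofTorusSite x) 0) *
            annihilation (orb (FermionTorus.ofTorusSite (x + Torus.proj L e)) 1))
              (dimerConfig T) (dimerConfig S) -
          (annihilation (orb (FermionTorus.ofTorusSite x) 1) *
            annihilation (orb (FermionTorus.ofTorusSite (x + Torus.proj L e)) 0))
              (dimerConfig T) (dimerConfig S))) =
      ((dWaveFormFactor (-𝐞) / Real.sqrt 2 : ℝ) : ℂ) *
          (annihilation (orb (FermionTorus.ofTorusSite x) 0) *
            annihilation (orb (FermionTorus.ofTorusSite (x + Torus.proj L (-𝐞))) 1))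
              (dimerConfig T) (dimerConfig S) -
        ((dWaveFormFactor 𝐞 / Real.sqrt 2 : ℝ) : ℂ) *
          (annihilation D[x] * annihilation U[x]) (dimerConfig T) (dimerConfig S) := by
    intro x
    simp_rw [mul_sub]
    rw [Finset.sum_sub_distrib, Finset.sum_eq_single_of_mem _ neg_e2_mem_steps,
      Finset.sum_eq_single_of_mem _ e2_mem_steps]
    · intro e he hne
      rw [entry_dn_up_eq_zero hL3 he hne, mul_zero]
    · intro e he hne
      rw [entry_up_dn_eq_zero hL3 he hne, mul_zero]
  rw [Finset.sum_congr rfl fun x _ => key x, Finset.sum_sub_distrib, dWave_e2, dWave_neg_e2,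
    ← Equiv.sum_comp (Equiv.addRight (Torus.proj L 𝐞))]
  simp only [Equiv.coe_addRight, shift_cancel]
  rw [← Finset.sum_sub_distrib]
  refine Finset.sum_congr rfl fun z _ => ?_
  rw [entry_up_dn_e2, entry_dn_up_e2]
  by_cases h : z ∉ T ∧ S = insert z T
  · have hz : z ∈ dimerSlots L := hS (h.2 ▸ mem_insert_self z T)
    rw [if_pos h, if_pos h, if_pos h, sign_up_dn hL hz h.1, sign_dn_up hL hz h.1, sqrt_two_aux]
  · rw [if_neg h, if_neg h, if_neg h, mul_zero, sub_zero]

end Summit.HubbardSuperconductivity.HubbardSuperconductivity.Theorems.DimerCondensate
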